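import Literature.Analysis.ODE.HeunMobius
import Literature.Geometry.Lorentzian.KerrDeSitterHeunEquivalence
import Literature.Geometry.Lorentzian.KerrDeSitterHiddenSymmetryKernel
import Literature.Geometry.Lorentzian.KerrDeSitterPartialModeStabilityNonzeroFreq
import HarnessLib

/-!
# Kerr–de Sitter: Hatsuda's Heun accessory parameter, pushed through Maier's Möbius automorphism,
# is the Euler-gauge accessory parameter of Casals–Teixeira da Costa's masses (route W, `K_A`)

Theorems only (NO named facts). The identity `mobiusQ_hatsuda_eq_eulerGaugeQ` below is the single
algebraic input `RouteW.AccessoryIdentity` of the pub-kds kernel `Summits/Ventures/KdS/RouteWTransfer.lean`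
(P1 g3): Hatsuda's Heun data of the radial Teukolsky equation — singular parameter `z_r`
(`mobiusZr`, (2.16)), exponent parameters `σ₊ = 2s+1`, `σ₋ = s+1−2B(r₋)`, `γ_H = 2B(r₊)+s+1`,
`δ_H = 2B(r_c)+s+1` ((2.20), (3.2)) and accessory quantity `v` ((2.21), `heunV`) — transported by the
Möbius automorphism `x = z_r(z−1)/z`, `y ↦ z^{−σ₋}y` of Heun's equation (Maier 2007, §3; image
accessory parameter `mobiusQ`, file `HeunMobius.lean`) equal the Euler-gauge accessory parameter
`eulerGaugeQ m₁ m₂ m₃ m₄ E z₂` of Casals–Teixeira da Costa's masses (3.15a), `E = E(z₂)/z₂` of (3.15b)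
(`ctdcEz₂`) and `z₂` of (3.14) (`ctdcZ₂`) (file `KerrDeSitterHiddenSymmetryKernel.lean`).

Structure of the proof (Casals–Teixeira da Costa, Lemma 3.5, is exactly this computation "after the
Möbius map"; the paper prints the result, not the bookkeeping):
* `B(r_j) = −η_j` for `j = 0,1,2` (`horizonB_rMinus_eq_neg_etaCauchy` here — valid also at `a = 0`,
  where both sides vanish —, `horizonB_rPlus_eq_neg_etaEvent`, `horizonB_rCosmo_eq_neg_etaCosmo`);
* `z_r/(z_r − 1) = z₂` and `z_r − 1 = (r₁−r₀)(r₂−r₃)/((r₂−r₁)(r₀−r₃))` (`mobiusZr_div_sub_one`,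
  `mobiusZr_sub_one`), `r₃ = −(r₀+r₁+r₂)`;
* with `B_j = iΞK(r_j)/Δ′(r_j)`, `K(r) = ω(r²+a²) − am`, the closed forms `Δ′(r_j) = −(Λ/3)∏(r_j − r_k)`
  (`deltaDeriv_r*_eq`) and `1 − α = (Λ/3)(S² − Σ r_ir_j)` (`vieta_sq`), both sides are the SAME
  rational function of `(ω, a, m, λ, s, r₀, r₁, r₂, Λ, Ξ)`: the parts quadratic in the `B_j` are
  `4z₂B₀B₁ + 4B₀B₂` on both sides, the `λ`-parts agree by `(z_r−1)(r₀−r₃)(r₁−r₂) = −(r₁−r₀)(r₂−r₃)`,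
  the `B`-linear parts by `ω r₀r₁ + (ωa² − am) = (r₁K(r₀) + r₀K(r₁))/(r₀+r₁)`, and the constant part
  is a polynomial identity in the roots after `vieta_sq` — `field_simp; ring`.

## References
* [Hatsuda2020] Y. Hatsuda, Quasinormal modes of Kerr–de Sitter black holes via the Heun function,
  Class. Quantum Grav. 38 (2020) 025015, arXiv:2006.08957: (2.15)–(2.21), (3.2).
* [Maier2007Heun192] R. S. Maier, The 192 solutions of the Heun equation, Math. Comp. 76 (2007), §3.
* [CasalsTeixeiradacosta2022] M. Casals, R. Teixeira da Costa, Commun. Math. Phys. 394 (2022),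
  arXiv:2105.13329: Lemma 3.5, (3.14)–(3.15).
-/

noncomputable section

open Complex Set

namespace Literature.Geometry.Lorentzian.KerrDeSitter

open Literature.Analysis.ODE Literature.Analysis.ODE.GeneralHeun

variable {M a Λ : ℝ}

/-- **`B(r₋) = −η₀`** (Cauchy horizon) on subextremal Kerr–de Sitter, including `a = 0` where both
sides vanish (`r₋ = 0`, `K(0) = 0`; the tree's `κ₀` and `ϖ₀` take junk values there, landing on `η₀ = 0`).
[cite: CasalsTeixeiradacosta2022, (3.10); Hatsuda2020, (2.20)] -/
theorem horizonB_rMinus_eq_neg_etaCauchy (hsub : IsSubextremal M a Λ) (ω : ℂ) (m : ℝ) :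
    horizonB M a Λ ω m (rMinus M a Λ) = -etaCauchy M a Λ ω m := by
  have hd := deltaDeriv_rMinus_eq hsub
  have hκ := surfaceGravity_rMinus_eq hsub
  have h0 := rMinus_nonneg M a Λ
  obtain ⟨hM, hΛ, h01, h12, -⟩ := hsub
  have hξ := xi_pos hΛ.le a
  have hP : 0 < Λ / 3 * (rPlus M a Λ - rMinus M a Λ) * (rCosmo M a Λ - rMinus M a Λ) *
      (2 * rMinus M a Λ + rPlus M a Λ + rCosmo M a Λ) :=
    mul_pos (mul_pos (mul_pos (by positivity) (by linarith)) (by linarith)) (by linarith)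
  unfold horizonB etaCauchy etaOf horizonAngVel radialK
  rw [hκ, hd]
  by_cases hra : rMinus M a Λ ^ 2 + a ^ 2 = 0
  · have ha : a = 0 := by nlinarith [sq_nonneg (rMinus M a Λ), sq_nonneg a]
    have hr : rMinus M a Λ = 0 := by nlinarith [sq_nonneg (rMinus M a Λ), sq_nonneg a]
    subst ha
    simp [hr]
  · have hra' : ((rMinus M a Λ : ℂ) ^ 2 + (a : ℂ) ^ 2) ≠ 0 := by exact_mod_cast hra
    have hP' : ((Λ / 3 * (rPlus M a Λ - rMinus M a Λ) * (rCosmo M a Λ - rMinus M a Λ) *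
      (2 * rMinus M a Λ + rPlus M a Λ + rCosmo M a Λ) : ℝ) : ℂ) ≠ 0 := by exact_mod_cast hP.ne'
    have hξ' : (xi a Λ : ℂ) ≠ 0 := by exact_mod_cast hξ.ne'
    push_cast at hra' hP' ⊢
    field_simp
    ring

/-- `z_r − 1 = (r₁−r₀)(r₂−r₃)/((r₂−r₁)(r₀−r₃))`, `r₃ = −(r₀+r₁+r₂)`. [cite: Hatsuda2020, (2.16)] -/
theorem mobiusZr_sub_one (hsub : IsSubextremal M a Λ) :
    mobiusZr M a Λ - 1 =
      (rPlus M a Λ - rMinus M a Λ) * (rCosmo M a Λ + (rMinus M a Λ + rPlus M a Λ + rCosmo M a Λ)) /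
        ((rCosmo M a Λ - rPlus M a Λ) * (rMinus M a Λ + (rMinus M a Λ + rPlus M a Λ + rCosmo M a Λ))) := by
  have h0 := rMinus_nonneg M a Λ
  obtain ⟨hM, hΛ, h01, h12, -⟩ := hsub
  unfold mobiusZr mobiusZ rNeg
  have h1 : rCosmo M a Λ - rPlus M a Λ ≠ 0 := by linarith
  have h2 : -(rMinus M a Λ + rPlus M a Λ + rCosmo M a Λ) - rMinus M a Λ ≠ 0 := by linarith
  have h3 : rMinus M a Λ + (rMinus M a Λ + rPlus M a Λ + rCosmo M a Λ) ≠ 0 := by linarith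
  field_simp
  ring

/-- `z_r/(z_r − 1) = z₂` (CTdC's (3.14)). [cite: CasalsTeixeiradacosta2022, Lemma 3.5 (3.14); Hatsuda2020, (2.16)] -/
theorem mobiusZr_div_sub_one (hsub : IsSubextremal M a Λ) :
    mobiusZr M a Λ / (mobiusZr M a Λ - 1) = ctdcZ₂ (rMinus M a Λ) (rPlus M a Λ) (rCosmo M a Λ) := by
  rw [mobiusZr_sub_one hsub]
  have h0 := rMinus_nonneg M a Λ
  obtain ⟨hM, hΛ, h01, h12, -⟩ := hsub
  unfold mobiusZr mobiusZ rNeg ctdcZ₂ ctdcZinf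
  have h1 : rCosmo M a Λ - rPlus M a Λ ≠ 0 := by linarith
  have h2 : -(rMinus M a Λ + rPlus M a Λ + rCosmo M a Λ) - rMinus M a Λ ≠ 0 := by linarith
  have h3 : rMinus M a Λ + (rMinus M a Λ + rPlus M a Λ + rCosmo M a Λ) ≠ 0 := by linarith
  have h4 : rPlus M a Λ - rMinus M a Λ ≠ 0 := by linarith
  have h5 : rCosmo M a Λ + (rMinus M a Λ + rPlus M a Λ + rCosmo M a Λ) ≠ 0 := by linarith
  field_simp
  ring

/-- **Hatsuda's `K`-term through `B₀, B₁`**: `ω r₀r₁ + ωa² − am = (r₁K(r₀) + r₀K(r₁))/(r₀+r₁)` and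
`iΞK(r_j) = Δ′(r_j)B(r_j)`, so the `ω`-dependent term of `v` (2.21) is
`6(1+2s)(r₁Δ′₀B₀ + r₀Δ′₁B₁)/((r₀+r₁)Λ(r₀−r₃)(r₀−r₁)(r₁−r₂))` (closed forms `Δ′_j = −(Λ/3)∏(r_j−r_k)`).
[cite: Hatsuda2020, (2.20)–(2.21)] -/
theorem heunV_eq_horizonB (hsub : IsSubextremal M a Λ) (s : ℝ) (ω : ℂ) (m : ℝ) (lam : ℂ) :
    heunV M a Λ s ω m lam =
      (((1 + s) * (1 + 2 * s) * rNeg M a Λ / (rMinus M a Λ - rNeg M a Λ) : ℝ) : ℂ) +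
        (3 * lam - ((6 * s * (1 - alpha a Λ)) : ℝ) +
            ((Λ * (1 + s) * (1 + 2 * s) * rPlus M a Λ * (rPlus M a Λ + rCosmo M a Λ) : ℝ) : ℂ)) /
          ((Λ * (rMinus M a Λ - rNeg M a Λ) * (rPlus M a Λ - rCosmo M a Λ) : ℝ) : ℂ) -
        6 * (1 + 2 * (s : ℂ)) *
            ((rPlus M a Λ : ℂ) *
                ((-(Λ / 3) * (rMinus M a Λ - rPlus M a Λ) * (rMinus M a Λ - rCosmo M a Λ) *
                    (2 * rMinus M a Λ + rPlus M a Λ + rCosmo M a Λ) : ℝ) : ℂ) *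
                  horizonB M a Λ ω m (rMinus M a Λ) +
              (rMinus M a Λ : ℂ) *
                ((-(Λ / 3) * (rPlus M a Λ - rMinus M a Λ) * (rPlus M a Λ - rCosmo M a Λ) *
                    (rMinus M a Λ + 2 * rPlus M a Λ + rCosmo M a Λ) : ℝ) : ℂ) *
                  horizonB M a Λ ω m (rPlus M a Λ)) /
          (((rMinus M a Λ + rPlus M a Λ : ℝ) : ℂ) *
            ((Λ * (rMinus M a Λ - rNeg M a Λ) * (rMinus M a Λ - rPlus M a Λ) *
              (rPlus M a Λ - rCosmo M a Λ) : ℝ) : ℂ)) := by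
  have hd0 := deltaDeriv_rMinus_eq hsub
  have hd1 := deltaDeriv_rPlus_eq hsub
  have h0 := rMinus_nonneg M a Λ
  obtain ⟨hM, hΛ, h01, h12, -⟩ := hsub
  unfold heunV horizonB radialK
  rw [hd0, hd1]
  unfold rNeg
  set x := rMinus M a Λ with hx
  set y := rPlus M a Λ with hy
  set zc := rCosmo M a Λ with hzc
  have hΛ' : (Λ : ℂ) ≠ 0 := by exact_mod_cast hΛ.ne'
  have f1 : (y : ℂ) - (x : ℂ) ≠ 0 := by exact_mod_cast (show y - x ≠ 0 by linarith)
  have f1' : (x : ℂ) - (y : ℂ) ≠ 0 := by exact_mod_cast (show x - y ≠ 0 by linarith)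
  have f2' : (x : ℂ) - (zc : ℂ) ≠ 0 := by exact_mod_cast (show x - zc ≠ 0 by linarith)
  have f3' : (y : ℂ) - (zc : ℂ) ≠ 0 := by exact_mod_cast (show y - zc ≠ 0 by linarith)
  have f4 : 2 * (x : ℂ) + (y : ℂ) + (zc : ℂ) ≠ 0 := by
    exact_mod_cast (show 2 * x + y + zc ≠ 0 by linarith)
  have f5 : (x : ℂ) + 2 * (y : ℂ) + (zc : ℂ) ≠ 0 := by
    exact_mod_cast (show x + 2 * y + zc ≠ 0 by linarith)
  have f7 : (x : ℂ) - -((x : ℂ) + (y : ℂ) + (zc : ℂ)) ≠ 0 := by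
    exact_mod_cast (show x - -(x + y + zc) ≠ 0 by linarith)
  have f8 : (x : ℂ) + (y : ℂ) ≠ 0 := by exact_mod_cast (show x + y ≠ 0 by linarith)
  have h3 : (3 : ℂ) ≠ 0 := by norm_num
  push_cast
  field_simp
  ring

/-- Partial fractions for `K(r) = ωr² + (ωa² − am)` over the roots of `Δ` (three-node form):
`(r₀−r₃)B₀ + (r₁−r₃)B₁ + (r₂−r₃)B₂ = −3iΞω/Λ`, `r₃ = −(r₀+r₁+r₂)`. [cite: Hatsuda2020, (2.20)] -/
theorem horizonB_weighted_sum (hsub : IsSubextremal M a Λ) (ω : ℂ) (m : ℝ) :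
    ((rMinus M a Λ + (rMinus M a Λ + rPlus M a Λ + rCosmo M a Λ) : ℝ) : ℂ) *
          horizonB M a Λ ω m (rMinus M a Λ) +
        ((rPlus M a Λ + (rMinus M a Λ + rPlus M a Λ + rCosmo M a Λ) : ℝ) : ℂ) *
          horizonB M a Λ ω m (rPlus M a Λ) +
        ((rCosmo M a Λ + (rMinus M a Λ + rPlus M a Λ + rCosmo M a Λ) : ℝ) : ℂ) *
          horizonB M a Λ ω m (rCosmo M a Λ) =
      -3 * (I * (xi a Λ : ℂ) * ω) / (Λ : ℂ) := by
  have hd0 := deltaDeriv_rMinus_eq hsub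
  have hd1 := deltaDeriv_rPlus_eq hsub
  have hd2 := deltaDeriv_rCosmo_eq hsub
  have h0 := rMinus_nonneg M a Λ
  obtain ⟨hM, hΛ, h01, h12, -⟩ := hsub
  unfold horizonB radialK
  rw [hd0, hd1, hd2]
  set x := rMinus M a Λ with hx
  set y := rPlus M a Λ with hy
  set zc := rCosmo M a Λ with hzc
  have hΛ' : (Λ : ℂ) ≠ 0 := by exact_mod_cast hΛ.ne'
  have f1 : (y : ℂ) - (x : ℂ) ≠ 0 := by exact_mod_cast (show y - x ≠ 0 by linarith)
  have f1' : (x : ℂ) - (y : ℂ) ≠ 0 := by exact_mod_cast (show x - y ≠ 0 by linarith)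
  have f2 : (zc : ℂ) - (x : ℂ) ≠ 0 := by exact_mod_cast (show zc - x ≠ 0 by linarith)
  have f2' : (x : ℂ) - (zc : ℂ) ≠ 0 := by exact_mod_cast (show x - zc ≠ 0 by linarith)
  have f3 : (zc : ℂ) - (y : ℂ) ≠ 0 := by exact_mod_cast (show zc - y ≠ 0 by linarith)
  have f3' : (y : ℂ) - (zc : ℂ) ≠ 0 := by exact_mod_cast (show y - zc ≠ 0 by linarith)
  have h3 : (3 : ℂ) ≠ 0 := by norm_num
  push_cast
  generalize hp₀ : (2 * (x : ℂ) + (y : ℂ) + (zc : ℂ)) = p₀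
  generalize hp₁ : ((x : ℂ) + 2 * (y : ℂ) + (zc : ℂ)) = p₁
  generalize hp₂ : ((x : ℂ) + (y : ℂ) + 2 * (zc : ℂ)) = p₂
  have hp₀' : p₀ ≠ 0 := by rw [← hp₀]; exact_mod_cast (show 2 * x + y + zc ≠ 0 by linarith)
  have hp₁' : p₁ ≠ 0 := by rw [← hp₁]; exact_mod_cast (show x + 2 * y + zc ≠ 0 by linarith)
  have hp₂' : p₂ ≠ 0 := by rw [← hp₂]; exact_mod_cast (show x + y + 2 * zc ≠ 0 by linarith)
  field_simp
  subst hp₀ hp₁ hp₂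
  ring

/-- `iΞω = (Δ′₁B₁ − Δ′₀B₀)/(r₁² − r₀²)` (from `Δ′_jB_j = iΞK(r_j)`, `K(r₁) − K(r₀) = ω(r₁²−r₀²)`; closed
forms `Δ′_j = −(Λ/3)∏(r_j − r_k)`). [cite: Hatsuda2020, (2.20)] -/
theorem I_xi_omega_eq (hsub : IsSubextremal M a Λ) (ω : ℂ) (m : ℝ) :
    I * (xi a Λ : ℂ) * ω =
      (((-(Λ / 3) * (rPlus M a Λ - rMinus M a Λ) * (rPlus M a Λ - rCosmo M a Λ) *
              (rMinus M a Λ + 2 * rPlus M a Λ + rCosmo M a Λ) : ℝ) : ℂ) *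
            horizonB M a Λ ω m (rPlus M a Λ) -
          ((-(Λ / 3) * (rMinus M a Λ - rPlus M a Λ) * (rMinus M a Λ - rCosmo M a Λ) *
              (2 * rMinus M a Λ + rPlus M a Λ + rCosmo M a Λ) : ℝ) : ℂ) *
            horizonB M a Λ ω m (rMinus M a Λ)) /
        (((rPlus M a Λ - rMinus M a Λ) * (rPlus M a Λ + rMinus M a Λ) : ℝ) : ℂ) := by
  have hd0 := deltaDeriv_rMinus_eq hsub
  have hd1 := deltaDeriv_rPlus_eq hsub
  have h0 := rMinus_nonneg M a Λ
  obtain ⟨hM, hΛ, h01, h12, -⟩ := hsub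
  unfold horizonB radialK
  rw [hd0, hd1]
  set x := rMinus M a Λ with hx
  set y := rPlus M a Λ with hy
  set zc := rCosmo M a Λ with hzc
  have hΛ' : (Λ : ℂ) ≠ 0 := by exact_mod_cast hΛ.ne'
  have f1 : (y : ℂ) - (x : ℂ) ≠ 0 := by exact_mod_cast (show y - x ≠ 0 by linarith)
  have f1' : (x : ℂ) - (y : ℂ) ≠ 0 := by exact_mod_cast (show x - y ≠ 0 by linarith)
  have f2' : (x : ℂ) - (zc : ℂ) ≠ 0 := by exact_mod_cast (show x - zc ≠ 0 by linarith)
  have f3' : (y : ℂ) - (zc : ℂ) ≠ 0 := by exact_mod_cast (show y - zc ≠ 0 by linarith)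
  have h3 : (3 : ℂ) ≠ 0 := by norm_num
  push_cast
  generalize hp₀ : (2 * (x : ℂ) + (y : ℂ) + (zc : ℂ)) = p₀
  generalize hp₁ : ((x : ℂ) + 2 * (y : ℂ) + (zc : ℂ)) = p₁
  generalize ht : ((y : ℂ) + (x : ℂ)) = t
  have hp₀' : p₀ ≠ 0 := by rw [← hp₀]; exact_mod_cast (show 2 * x + y + zc ≠ 0 by linarith)
  have hp₁' : p₁ ≠ 0 := by rw [← hp₁]; exact_mod_cast (show x + 2 * y + zc ≠ 0 by linarith)
  have ht' : t ≠ 0 := by rw [← ht]; exact_mod_cast (show y + x ≠ 0 by linarith)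
  field_simp
  subst hp₀ hp₁ ht
  ring

/-- **`B₂` through `B₀, B₁`**: `B₂ = (−3iΞω/Λ − (r₀−r₃)B₀ − (r₁−r₃)B₁)/(r₂−r₃)` with `iΞω` from
`I_xi_omega_eq`. [cite: Hatsuda2020, (2.20)] -/
theorem horizonB_rCosmo_eq_comb (hsub : IsSubextremal M a Λ) (ω : ℂ) (m : ℝ) :
    horizonB M a Λ ω m (rCosmo M a Λ) =
      (-3 *
            ((((-(Λ / 3) * (rPlus M a Λ - rMinus M a Λ) * (rPlus M a Λ - rCosmo M a Λ) *
                    (rMinus M a Λ + 2 * rPlus M a Λ + rCosmo M a Λ) : ℝ) : ℂ) *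
                  horizonB M a Λ ω m (rPlus M a Λ) -
                ((-(Λ / 3) * (rMinus M a Λ - rPlus M a Λ) * (rMinus M a Λ - rCosmo M a Λ) *
                    (2 * rMinus M a Λ + rPlus M a Λ + rCosmo M a Λ) : ℝ) : ℂ) *
                  horizonB M a Λ ω m (rMinus M a Λ)) /
              (((rPlus M a Λ - rMinus M a Λ) * (rPlus M a Λ + rMinus M a Λ) : ℝ) : ℂ)) /
            (Λ : ℂ) -
          ((rMinus M a Λ + (rMinus M a Λ + rPlus M a Λ + rCosmo M a Λ) : ℝ) : ℂ) *
            horizonB M a Λ ω m (rMinus M a Λ) -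
          ((rPlus M a Λ + (rMinus M a Λ + rPlus M a Λ + rCosmo M a Λ) : ℝ) : ℂ) *
            horizonB M a Λ ω m (rPlus M a Λ)) /
        ((rCosmo M a Λ + (rMinus M a Λ + rPlus M a Λ + rCosmo M a Λ) : ℝ) : ℂ) := by
  have A := horizonB_weighted_sum hsub ω m
  rw [I_xi_omega_eq hsub ω m] at A
  have h0 := rMinus_nonneg M a Λ
  obtain ⟨hM, hΛ, h01, h12, -⟩ := hsub
  have hz : ((rCosmo M a Λ + (rMinus M a Λ + rPlus M a Λ + rCosmo M a Λ) : ℝ) : ℂ) ≠ 0 := by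
    exact_mod_cast (show rCosmo M a Λ + (rMinus M a Λ + rPlus M a Λ + rCosmo M a Λ) ≠ 0 by linarith)
  rw [eq_div_iff hz]
  linear_combination A

set_option maxRecDepth 8000 in
set_option maxHeartbeats 1600000 in
/-- **Route W, `K_A`'s residual identity.** On subextremal Kerr–de Sitter (any `0 ≤ a`), Hatsuda's
Heun accessory quantity pushed through the Möbius automorphism equals the Euler-gauge accessory
parameter of Casals–Teixeira da Costa's masses with `E = E(z₂)/z₂` and `z₂` of (3.14)–(3.15)
(`λ̄`-block `(3/Λ)(λ̄ − 2Ξ²amω + a²Ξ²ω²)/((r_c − r_neg)(r₊ − r₋))`).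
[cite: CasalsTeixeiradacosta2022, Lemma 3.5 (3.14)–(3.15); Hatsuda2020, (2.16), (2.20)–(2.21); Maier2007Heun192, §3] -/
theorem mobiusQ_hatsuda_eq_eulerGaugeQ (hsub : IsSubextremal M a Λ) (s : ℝ) (ω : ℂ) (m : ℝ)
    (lam : ℂ) :
    mobiusQ (mobiusZr M a Λ) (heunSigmaPlus s) (heunSigmaMinus M a Λ s ω m) (heunGamma M a Λ s ω m)
        (heunDelta M a Λ s ω m) (heunV M a Λ s ω m lam) =
      eulerGaugeQ (sqcdM₁ (s : ℂ) (etaCauchy M a Λ ω m) (etaEvent M a Λ ω m))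
        (sqcdM₂ (etaCauchy M a Λ ω m) (etaEvent M a Λ ω m))
        (sqcdM₃ (s : ℂ) (etaCauchy M a Λ ω m) (etaEvent M a Λ ω m))
        (sqcdM₄ (etaCauchy M a Λ ω m) (etaEvent M a Λ ω m) (etaCosmo M a Λ ω m))
        (ctdcEz₂ (s : ℂ) (etaCauchy M a Λ ω m) (etaEvent M a Λ ω m) (etaCosmo M a Λ ω m)
            (((3 / Λ : ℝ) : ℂ) *
                (lambdaBar a Λ s ω m lam - 2 * (xi a Λ : ℂ) ^ 2 * (a : ℂ) * (m : ℂ) * ω +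
                  (a : ℂ) ^ 2 * (xi a Λ : ℂ) ^ 2 * ω ^ 2) /
              ((((rCosmo M a Λ - rNeg M a Λ) * (rPlus M a Λ - rMinus M a Λ)) : ℝ) : ℂ))
            ((ctdcZ₂ (rMinus M a Λ) (rPlus M a Λ) (rCosmo M a Λ) : ℝ) : ℂ)
            (rMinus M a Λ) (rPlus M a Λ) (rCosmo M a Λ) /
          ((ctdcZ₂ (rMinus M a Λ) (rPlus M a Λ) (rCosmo M a Λ) : ℝ) : ℂ))
        ((ctdcZ₂ (rMinus M a Λ) (rPlus M a Λ) (rCosmo M a Λ) : ℝ) : ℂ) := by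
  -- the dictionary `η_j = −B_j` on the right; `v` and `B₂` through `B₀, B₁`
  have e0 : etaCauchy M a Λ ω m = -horizonB M a Λ ω m (rMinus M a Λ) := by
    rw [horizonB_rMinus_eq_neg_etaCauchy hsub, neg_neg]
  have e1 : etaEvent M a Λ ω m = -horizonB M a Λ ω m (rPlus M a Λ) := by
    rw [horizonB_rPlus_eq_neg_etaEvent hsub, neg_neg]
  have e2 : etaCosmo M a Λ ω m = -horizonB M a Λ ω m (rCosmo M a Λ) := by
    rw [horizonB_rCosmo_eq_neg_etaCosmo hsub, neg_neg]
  have hzr := mobiusZr_div_sub_one hsub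
  have hzr1 := mobiusZr_sub_one hsub
  have hv := vieta_sq hsub
  have hV := heunV_eq_horizonB hsub s ω m lam
  have hB2 := horizonB_rCosmo_eq_comb hsub ω m
  have h0 := rMinus_nonneg M a Λ
  obtain ⟨hM, hΛ, h01, h12, -⟩ := hsub
  rw [e0, e1, e2, hV]
  unfold heunSigmaPlus heunSigmaMinus heunGamma heunDelta
  rw [hB2]
  unfold mobiusQ
  rw [hzr]
  have hc : ((mobiusZr M a Λ : ℝ) : ℂ) - 1 = (((mobiusZr M a Λ - 1 : ℝ)) : ℂ) := by push_cast; ring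
  rw [hc, hzr1]
  unfold eulerGaugeQ sqcdM₁ sqcdM₂ sqcdM₃ sqcdM₄ ctdcEz₂ lambdaBar alpha
  rw [hv]
  unfold ctdcZ₂ ctdcZinf rNeg
  set B₀ := horizonB M a Λ ω m (rMinus M a Λ) with hB₀
  set B₁ := horizonB M a Λ ω m (rPlus M a Λ) with hB₁
  set x := rMinus M a Λ with hx
  set y := rPlus M a Λ with hy
  set zc := rCosmo M a Λ with hzc
  simp only [sub_neg_eq_add]
  -- nonvanishing of the two-term factors (complex casts)
  have hΛ' : (Λ : ℂ) ≠ 0 := by exact_mod_cast hΛ.ne'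
  have f1 : (y : ℂ) - (x : ℂ) ≠ 0 := by exact_mod_cast (show y - x ≠ 0 by linarith)
  have f1' : (x : ℂ) - (y : ℂ) ≠ 0 := by exact_mod_cast (show x - y ≠ 0 by linarith)
  have f2 : (zc : ℂ) - (x : ℂ) ≠ 0 := by exact_mod_cast (show zc - x ≠ 0 by linarith)
  have f2' : (x : ℂ) - (zc : ℂ) ≠ 0 := by exact_mod_cast (show x - zc ≠ 0 by linarith)
  have f3 : (zc : ℂ) - (y : ℂ) ≠ 0 := by exact_mod_cast (show zc - y ≠ 0 by linarith)
  have f3' : (y : ℂ) - (zc : ℂ) ≠ 0 := by exact_mod_cast (show y - zc ≠ 0 by linarith)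
  have h2 : (2 : ℂ) ≠ 0 := by norm_num
  have h3 : (3 : ℂ) ≠ 0 := by norm_num
  have h4 : (4 : ℂ) ≠ 0 := by norm_num
  push_cast
  -- the compound linear factors become atoms for `field_simp`, and are substituted back for `ring`
  generalize hq₀ : ((x : ℂ) + ((x : ℂ) + (y : ℂ) + (zc : ℂ))) = q₀
  generalize hq₁ : ((y : ℂ) + ((x : ℂ) + (y : ℂ) + (zc : ℂ))) = q₁
  generalize hq₂ : ((zc : ℂ) + ((x : ℂ) + (y : ℂ) + (zc : ℂ))) = q₂
  generalize hp₀ : (2 * (x : ℂ) + (y : ℂ) + (zc : ℂ)) = p₀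
  generalize hp₁ : ((x : ℂ) + 2 * (y : ℂ) + (zc : ℂ)) = p₁
  generalize ht₁ : ((x : ℂ) + (y : ℂ)) = t₁
  generalize ht₂ : ((y : ℂ) + (x : ℂ)) = t₂
  have hq₀' : q₀ ≠ 0 := by rw [← hq₀]; exact_mod_cast (show x + (x + y + zc) ≠ 0 by linarith)
  have hq₁' : q₁ ≠ 0 := by rw [← hq₁]; exact_mod_cast (show y + (x + y + zc) ≠ 0 by linarith)
  have hq₂' : q₂ ≠ 0 := by rw [← hq₂]; exact_mod_cast (show zc + (x + y + zc) ≠ 0 by linarith)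
  have hp₀' : p₀ ≠ 0 := by rw [← hp₀]; exact_mod_cast (show 2 * x + y + zc ≠ 0 by linarith)
  have hp₁' : p₁ ≠ 0 := by rw [← hp₁]; exact_mod_cast (show x + 2 * y + zc ≠ 0 by linarith)
  have ht₁' : t₁ ≠ 0 := by rw [← ht₁]; exact_mod_cast (show x + y ≠ 0 by linarith)
  have ht₂' : t₂ ≠ 0 := by rw [← ht₂]; exact_mod_cast (show y + x ≠ 0 by linarith)
  field_simp
  subst hq₀ hq₁ hq₂ hp₀ hp₁ ht₁ ht₂
  ring

end Literature.Geometry.Lorentzian.KerrDeSitter
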